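import Mathlib
import Summits.Ventures.PercRepro2.CoinKSureGate

/-!
# Lemmas for the coin-resolved layer cake (blind cell PercRepro2, night-2 g21;
proofs/NIGHT2-DARC.md §61)

Three small facts on `U.powerset` used by `twoGate_functional_nonneg`: the centred product
expanded into the four moments (`expand_centred`); the within-state FKG in centred form — the
state means of a log-supermodular gate may replace the markers in the centred sum
(`within_state_bound`, from `sum_fiber_prod_le`); and FKG on a join-closed set — a
log-supermodular law restricted to a set closed under joins on its support has increasing-marker
mean above the global one (`upset_mean`, from `ad_pointwise`).
-/

namespace Summit.Ventures.PercRepro2.Coin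

open Classical

section LayerCakeAbstract

variable {V : Type*} [DecidableEq V] {R : Type*} [Field R] [LinearOrder R] [IsStrictOrderedRing R]

omit [DecidableEq V] [LinearOrder R] [IsStrictOrderedRing R] in
/-- The centred product expanded into the four moments. -/
lemma expand_centred (S : Finset (Finset V)) (G' a b : Finset V → R) (Λ Λ₁ Λ₂ : R) :
    (∑ W ∈ S, G' W * ((Λ * a W - Λ₁) * (Λ * b W - Λ₂))) =
      Λ * Λ * (∑ W ∈ S, G' W * (a W * b W)) - Λ * Λ₂ * (∑ W ∈ S, G' W * a W)
        - Λ * Λ₁ * (∑ W ∈ S, G' W * b W) + Λ₁ * Λ₂ * (∑ W ∈ S, G' W) := by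
  rw [Finset.mul_sum, Finset.mul_sum, Finset.mul_sum, Finset.mul_sum,
    ← Finset.sum_sub_distrib, ← Finset.sum_sub_distrib, ← Finset.sum_add_distrib]
  exact Finset.sum_congr rfl fun W _ => by ring

/-- **Within-state FKG, centred form**: replacing the markers by their state means (under a
log-supermodular gate `G'`) can only decrease the centred sum. -/
lemma within_state_bound (U ent : Finset V) (G' x y : Finset V → R) (Λ Λ₁ Λ₂ : R) (hΛ0 : 0 ≤ Λ)
    (hG' : ∀ W, 0 ≤ G' W) (hx0 : ∀ W, 0 ≤ x W) (hy0 : ∀ W, 0 ≤ y W)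
    (hxm : ∀ s t, x s ≤ x (s ∪ t)) (hym : ∀ s t, y s ≤ y (s ∪ t))
    (wMM : ∀ s ⊆ U, ∀ t ⊆ U, G' s * G' t ≤ G' (s ∩ t) * G' (s ∪ t)) :
    (∑ W ∈ U.powerset, G' W *
        ((Λ * ((∑ W' ∈ U.powerset.filter (fun W' => W' ∩ ent = W ∩ ent), G' W' * x W') /
          (∑ W' ∈ U.powerset.filter (fun W' => W' ∩ ent = W ∩ ent), G' W')) - Λ₁) *
         (Λ * ((∑ W' ∈ U.powerset.filter (fun W' => W' ∩ ent = W ∩ ent), G' W' * y W') /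
          (∑ W' ∈ U.powerset.filter (fun W' => W' ∩ ent = W ∩ ent), G' W')) - Λ₂))) ≤
      ∑ W ∈ U.powerset, G' W * ((Λ * x W - Λ₁) * (Λ * y W - Λ₂)) := by
  rw [expand_centred, expand_centred]
  have hprod := sum_fiber_prod_le U ent G' x y hG' hx0 hy0 hxm hym wMM
  have hmx := sum_mean_eq U ent G' x hG'
  have hmy := sum_mean_eq U ent G' y hG'
  rw [hmx, hmy]
  have := mul_le_mul_of_nonneg_left hprod (mul_nonneg hΛ0 hΛ0)
  linarith

/-- **FKG on a join-closed set**: for a log-supermodular law and an increasing marker, the law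
restricted to a set `P` closed under joins (on the support) has marker mean above the global one. -/
lemma upset_mean (U : Finset V) (G' x : Finset V → R) (hG' : ∀ W, 0 ≤ G' W)
    (hx0 : ∀ W, 0 ≤ x W) (hxm : ∀ s t, x s ≤ x (s ∪ t))
    (wMM : ∀ s ⊆ U, ∀ t ⊆ U, G' s * G' t ≤ G' (s ∩ t) * G' (s ∪ t))
    (P : Finset V → Prop) [DecidablePred P]
    (hP : ∀ s ⊆ U, ∀ t ⊆ U, P s → G' s ≠ 0 → G' t ≠ 0 → P (s ∪ t)) :
    (∑ W ∈ U.powerset.filter P, G' W) * (∑ W ∈ U.powerset, G' W * x W) ≤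
      (∑ W ∈ U.powerset, G' W) * (∑ W ∈ U.powerset.filter P, G' W * x W) := by
  simp only [Finset.sum_filter]
  have n₁ : ∀ W, (0 : R) ≤ (if P W then G' W else 0) := fun W => by
    split_ifs <;> [exact hG' W; exact le_rfl]
  have n₂ : ∀ W, (0 : R) ≤ G' W * x W := fun W => mul_nonneg (hG' W) (hx0 W)
  have n₃ : ∀ W, (0 : R) ≤ G' W := hG'
  have n₄ : ∀ W, (0 : R) ≤ (if P W then G' W * x W else 0) := fun W => by
    split_ifs <;> [exact mul_nonneg (hG' W) (hx0 W); exact le_rfl]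
  refine ad_pointwise U _ _ _ _ n₁ n₂ n₃ n₄ ?_
  intro s hs t ht
  by_cases hPs : P s
  · rw [if_pos hPs]
    by_cases hs0 : G' s = 0
    · rw [hs0, zero_mul]; exact mul_nonneg (n₃ _) (n₄ _)
    · by_cases ht0 : G' t = 0
      · rw [ht0, zero_mul, mul_zero]; exact mul_nonneg (n₃ _) (n₄ _)
      · have hPu : P (s ∪ t) := hP s hs t ht hPs hs0 ht0
        rw [if_pos hPu]
        have hxt : x t ≤ x (s ∪ t) := by rw [Finset.union_comm]; exact hxm t s
        calc G' s * (G' t * x t) = (G' s * G' t) * x t := by ring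
          _ ≤ (G' (s ∩ t) * G' (s ∪ t)) * x (s ∪ t) :=
              mul_le_mul (wMM s hs t ht) hxt (hx0 t) (mul_nonneg (hG' _) (hG' _))
          _ = G' (s ∩ t) * (G' (s ∪ t) * x (s ∪ t)) := by ring
  · rw [if_neg hPs, zero_mul]; exact mul_nonneg (n₃ _) (n₄ _)

end LayerCakeAbstract

end Summit.Ventures.PercRepro2.Coin
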